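import Summits.KontsevichZagierPeriods.KontsevichZagierPeriods.Theorems.RootDecompWalshStrataOctantPolar

/-!
# The pointless octant, part 3/4: the second Newton–Leibniz move

Newton–Leibniz along `s` over `(0,1)` with the ALGEBRAIC primitive `octF = −(7√7/96)(1−s²)√(1−s²)/(1+t²)`
(closed fibres `[0,1]`, then null faces): `of_polRep_sub_of_arcRep_mem_relations :
[(0,1)², c√(1−s²)·2s/(1+t²)] − [(0,1), (7√7/96)/(1+t²)] ∈ KZ.relations`; `arcRep` is the `arctan`
integrand with the irrational algebraic coefficient `7√7/96` (not yet of KZ's rational shape).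
Imports: part 2; 0 sorry. [KontsevichZagier2001 §1.2 rules (1), (3)]
-/

noncomputable section

open Literature.NumberTheory.Transcendental
open MeasureTheory Set
open MvPolynomial (aeval X C)
open Literature.ModelTheory.ExponentialFields (IsSemialgebraic isSemialgebraic_setOf_eval_pos
  isSemialgebraic_setOf_eval_lt continuous_aeval_real)
open Summit.KontsevichZagierPeriods.RootDecompWalshStrata.WalshSpanProof (isSemialgebraic_cubeSet
  isBounded_cubeSet cellRep cellRep_domain cellRep_integrand)
open Summit.KontsevichZagierPeriods.RootDecompWalshStrata.ConeSpecimen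

namespace Summit.KontsevichZagierPeriods.RootDecompWalshStrata.PointlessOctant

/-! #### Newton–Leibniz along `s`: `[(0,1)², c·√(1−s²)·2s/(1+t²)] ≡ [(0,1), (2c/3)/(1+t²)]` -/

/-- The integrand `c·√(1−s²)·2s/(1+t²)` is continuous on `ℝ²`. -/
theorem continuous_polIntegrand : Continuous polRep.integrand := by
  show Continuous fun p : Fin 2 → ℝ =>
    (7 / 64 : ℝ) * √7 * √(1 - p 1 ^ 2) * (2 * p 1 / (1 + p 0 ^ 2))
  refine (continuous_const.mul (Real.continuous_sqrt.comp
    (continuous_const.sub ((continuous_apply 1).pow 2)))).mul (Continuous.div ?_ ?_ fun p => ?_)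
  · exact continuous_const.mul (continuous_apply 1)
  · exact continuous_const.add ((continuous_apply 0).pow 2)
  · positivity

/-- The primitive along `s`: `F(t,s) = −(2c/3)·(1−s²)√(1−s²)/(1+t²)`, `2c/3 = 7√7/96`. -/
def octF (p : Fin 2 → ℝ) : ℝ := -(7 / 96 : ℝ) * √7 * ((1 - p 1 ^ 2) * √(1 - p 1 ^ 2)) / (1 + p 0 ^ 2)

/-- `F` is `ℚ`-semialgebraic on any `ℚ`-semialgebraic set. [BCR1998 §2.2] -/
theorem isSemialgebraicFunOn_octF {s : Set (Fin 2 → ℝ)} (hs : IsSemialgebraic ℚ s) :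
    IsSemialgebraicFunOn ℚ s octF :=
  (IsSemialgebraicFunOn.mul_holds
    (IsSemialgebraicFunOn.mul_holds
      (isSemialgebraicFunOn_aeval_div_aeval hs (C (-7 / 96) * (1 - X 1 ^ 2)) (1 + X 0 ^ 2)
        fun p _ => by
          have h : (0:ℝ) < 1 + p 0 ^ 2 := by positivity
          simpa using h.ne')
      (IsSemialgebraicFunOn.sqrt_holds (isSemialgebraicFunOn_aeval hs (1 - X 1 ^ 2))))
    (IsSemialgebraicFunOn.sqrt_holds (isSemialgebraicFunOn_ratCast hs 7))).congr fun p _ => by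
      simp only [Pi.mul_apply, map_mul, map_sub, map_add, map_one, map_pow, MvPolynomial.aeval_C,
        MvPolynomial.aeval_X, eq_ratCast, octF]
      push_cast
      ring

/-- `[(0,1), (7√7/96)/(1 + t²)]` — the `arctan` integrand with the irrational algebraic
coefficient `7√7/96` (NOT of KZ's rational shape). [KontsevichZagier2001 §1.1] -/
def arcRep : KZ.IntegralRep 1 where
  domain := unitIoo
  integrand x := (7 / 96 : ℝ) * √7 / (1 + x 0 ^ 2)
  isSemialgebraic_domain := isSemialgebraic_unitIoo
  isSemialgebraicFunOn_integrand :=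
    (IsSemialgebraicFunOn.mul_holds
      (isSemialgebraicFunOn_aeval_div_aeval isSemialgebraic_unitIoo (C (7 / 96)) (1 + X 0 ^ 2)
        fun x _ => by
          have h : (0:ℝ) < 1 + x 0 ^ 2 := by positivity
          simpa using h.ne')
      (IsSemialgebraicFunOn.sqrt_holds (isSemialgebraicFunOn_ratCast isSemialgebraic_unitIoo 7))).congr
      fun x _ => by
        simp only [Pi.mul_apply, map_add, map_one, map_pow, MvPolynomial.aeval_C,
          MvPolynomial.aeval_X, eq_ratCast]
        push_cast
        ring
  integrableOn := by
    refine (ContinuousOn.integrableOn_compact isCompact_Icc ?_).mono_set unitIoo_subset_Icc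
    have hc : Continuous fun x : Fin 1 → ℝ => (7 / 96 : ℝ) * √7 / (1 + x 0 ^ 2) := by
      refine Continuous.div continuous_const ?_ fun x => ?_
      · exact continuous_const.add ((continuous_apply 0).pow 2)
      · positivity
    exact hc.continuousOn

/-- The domain of `arcRep` (the unit interval). [folklore] -/
@[simp] theorem arcRep_domain : arcRep.domain = unitIoo := rfl

/-- The integrand of `arcRep`. [folklore] -/
@[simp] theorem arcRep_integrand (x : Fin 1 → ℝ) :
    arcRep.integrand x = (7 / 96 : ℝ) * √7 / (1 + x 0 ^ 2) := rfl

/-- The box `(0,1)²` is the open band `0 < s < 1` over `(0,1)`. -/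
theorem mem_boxTwo_iff_init (z : Fin 2 → ℝ) :
    z ∈ boxTwo ↔ Fin.init z ∈ unitIoo ∧ 0 < z (Fin.last 1) ∧ z (Fin.last 1) < 1 := by
  simp only [boxTwo, mem_setOf_eq, mem_unitIoo, Fin.init]
  constructor
  · intro hz
    exact ⟨by simpa using hz 0, (hz 1).1, (hz 1).2⟩
  · rintro ⟨h0, h1, h2⟩
    intro j
    fin_cases j
    · simpa using h0
    · exact ⟨h1, h2⟩

/-- The closed band `[0,1]` over `(0,1)` lies in the closed unit square. [folklore] -/
theorem band_unitIoo01_subset_Icc :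
    KZlog.band unitIoo (fun _ => (0:ℝ)) (fun _ => 1) ⊆ Icc 0 1 := by
  intro z hz
  rw [KZlog.mem_band] at hz
  obtain ⟨hu, h0, h1⟩ := hz
  rw [mem_unitIoo] at hu
  have hu' : 0 < z 0 ∧ z 0 < 1 := by simpa [Fin.init] using hu
  refine ⟨fun j => ?_, fun j => ?_⟩
  · fin_cases j
    · exact hu'.1.le
    · simpa using h0
  · fin_cases j
    · exact hu'.2.le
    · simpa using h1

/-- `d/ds [(1 − s²)√(1 − s²)] · (−1/3) = s√(1−s²)`: the key identity `(1−s²)/√(1−s²) = √(1−s²)`. -/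
theorem deriv_key (t : ℝ) :
    (1 - t ^ 2) * (-(2 * t) / (2 * √(1 - t ^ 2))) = -(t * √(1 - t ^ 2)) := by
  rw [show (1 - t ^ 2) * (-(2 * t) / (2 * √(1 - t ^ 2))) = -(t * ((1 - t ^ 2) / √(1 - t ^ 2))) by
    ring, Real.div_sqrt]

/-- **Moves (3) + (1a):** `[(0,1)², c·√(1−s²)·2s/(1+t²)] ≡ [(0,1), (7√7/96)/(1+t²)]` —
Newton–Leibniz along `s` with the ALGEBRAIC primitive `−(7√7/96)(1−s²)√(1−s²)/(1+t²)` (closed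
fibres `[0,1]`), then opening the fibres. [KontsevichZagier2001 §1.2 rules (1), (3)] -/
theorem of_polRep_sub_of_arcRep_mem_relations :
    KZ.of polRep - KZ.of arcRep ∈ KZ.relations := by
  have hBs := isSemialgebraic_unitIoo
  have ha : IsSemialgebraicFunOn ℚ unitIoo (fun _ => (0:ℝ)) := by
    simpa using isSemialgebraicFunOn_ratCast hBs 0
  have hb : IsSemialgebraicFunOn ℚ unitIoo (fun _ => (1:ℝ)) := by
    simpa using isSemialgebraicFunOn_ratCast hBs 1
  have hband : IsSemialgebraic ℚ (KZlog.band unitIoo (fun _ => (0:ℝ)) (fun _ => 1)) :=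
    KZlog.isSemialgebraic_band ha hb
  obtain ⟨rb, rd, hrbd, hrbi, hrdd, hrdi, hrel⟩ := KZ.exists_band_newtonLeibniz hBs
    (fun _ => (0:ℝ)) (fun _ => 1) ha hb (fun _ _ => zero_le_one)
    octF polRep.integrand
    (isSemialgebraicFunOn_octF hband)
    ((IsSemialgebraicFunOn.mul_holds
      (IsSemialgebraicFunOn.mul_holds (isSemialgebraicFunOn_octConst hband)
        (IsSemialgebraicFunOn.sqrt_holds (isSemialgebraicFunOn_aeval hband (1 - X 1 ^ 2))))
      (isSemialgebraicFunOn_aeval_div_aeval hband (2 * X 1) (1 + X 0 ^ 2)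
        fun p _ => by
          have h : (0:ℝ) < 1 + p 0 ^ 2 := by positivity
          simpa using h.ne')).congr fun p _ => by simp)
    (fun x _ => by
      simp only [octF, snoc₁_apply]
      exact ((continuous_const.mul ((continuous_const.sub (continuous_id.pow 2)).mul
        (Real.continuous_sqrt.comp (continuous_const.sub (continuous_id.pow 2))))).div_const
          _).continuousOn)
    (fun x _ t ht => by
      have hgpos : 0 < 1 - t ^ 2 := by nlinarith [ht.1, ht.2]
      have hg : HasDerivAt (fun t : ℝ => 1 - t ^ 2) (-(2 * t)) t := by
        simpa using (hasDerivAt_pow 2 t).const_sub 1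
      have hsqrt := hg.sqrt hgpos.ne'
      have hprod := hg.mul hsqrt
      have hF := (hprod.const_mul (-(7 / 96 : ℝ) * √7)).div_const (1 + x 0 ^ 2)
      simp only [octF, snoc₁_apply, polRep_integrand]
      refine hF.congr_deriv ?_
      rw [deriv_key]
      ring)
    ((continuous_polIntegrand.continuousOn.integrableOn_compact isCompact_Icc).mono_set
      band_unitIoo01_subset_Icc)
    (arcRep.isSemialgebraicFunOn_integrand.congr fun x _ => by
      simp only [arcRep_integrand, octF, snoc₁_apply]
      norm_num; ring)
    (by
      have : (fun x : Fin 1 → ℝ => octF (Fin.snoc x ((fun _ : Fin 1 → ℝ => (1:ℝ)) x)) -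
          octF (Fin.snoc x ((fun _ : Fin 1 → ℝ => (0:ℝ)) x))) = arcRep.integrand := by
        funext x
        simp only [arcRep_integrand, octF, snoc₁_apply]
        norm_num; ring
      rw [this]
      exact arcRep.integrableOn)
  obtain ⟨rb', hrb'd, hrb'i, hrel'⟩ := KZ.of_sub_of_restrict_openBand_mem_relations ha hb rb hrbd
  have hpin1 : KZ.of rb' - KZ.of polRep ∈ KZ.relations := by
    refine KZ.of_sub_of_mem_relations_of_eqOn ?_ fun z _ => ?_
    · rw [hrb'd, polRep_domain]
      ext z
      simpa using mem_boxTwo_iff_init z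
    · rw [hrb'i, hrbi]
  have hpin2 : KZ.of rd - KZ.of arcRep ∈ KZ.relations := by
    refine KZ.of_sub_of_mem_relations_of_eqOn ?_ fun u _ => ?_
    · rw [hrdd]; rfl
    · rw [hrdi]
      simp only [arcRep_integrand, octF, snoc₁_apply]
      norm_num; ring
  have : KZ.of polRep - KZ.of arcRep =
      (KZ.of rb - KZ.of rd) - (KZ.of rb - KZ.of rb') - (KZ.of rb' - KZ.of polRep) +
        (KZ.of rd - KZ.of arcRep) := by abel
  rw [this]
  exact add_mem (sub_mem (sub_mem hrel hrel') hpin1) hpin2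


end Summit.KontsevichZagierPeriods.RootDecompWalshStrata.PointlessOctant

end
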